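import Summits.AtomisticToContinuum.BoseEinsteinCondensation.Theorems.BECThomsonPrincipleGDTransferDefs

/-!
# Route `BECThomsonPrinciple`, crux `GDTransfer` (stmt-AtomisticToContinuum-9482), line `dyson-dressed-witness`:
# stub `chordVariation`, part 1 — sesquilinearity of the source pairing `srcPair`

Support file of `stub_chordVariation` (`GaussianDominationCan → TwoSidedDualNorm`).  The crux's mode
projections `Q_S` (`Negative.modeProj`, a `foldr` of cell averages `P_i` / fluctuations `1 - P_i`) and
`Θ = Σ_{S∋0}|S|^{-1/2}Q_S` (`Negative.theta`) preserve continuity and are `ℂ`-linear on continuous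
functions (`P_i` is additive on continuous functions, `Negative.cellAvg_add`, and homogeneous,
`Negative.cellAvg_const_mul`); hence the source pairing
`σ_n(g, h) = ∫_{cell^N} conj(g) e^{ik·x₀} Θ_h` (`srcPair`) is conjugate-linear in `g`, linear in `h`
on continuous functions, and along a line `ψ + cζ` its diagonal is the quadratic polynomial
`σ(ψ+cζ, ψ+cζ) = σ(ψ,ψ) + (conj(c)σ(ζ,ψ) + cσ(ψ,ζ)) + |c|²σ(ζ,ζ)` (`srcPair_line`).  Also: the diagonal
vanishes on functions of zero mass (`srcPair_self_eq_zero_of_mass_eq_zero`).  All [folklore].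
-/

noncomputable section

open MeasureTheory Filter
open scoped ENNReal NNReal ComplexConjugate

namespace Summit.AtomisticToContinuum.BoseEinsteinCondensation.Cruxes.GDTransfer.DysonDressedWitness

namespace ChordVariation

open Literature.MathematicalPhysics.QuantumManyBody.BoseGas
open Summit.AtomisticToContinuum.BoseEinsteinCondensation.Theorems.GaussianDominationCan.Negative

variable {N m : ℕ} {L : ℝ}

/-! ## Continuity of `Q_S`, `Θ`, `e^{ik·x₀}` -/

/-- Each step `P_i` / `1 - P_i` of the crux's `foldr` preserves continuity. [folklore] -/
theorem continuous_foldr_cellAvg (S : Finset (Fin N)) (l : List (Fin N)) {g : Config N → ℂ}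
    (hg : Continuous g) :
    Continuous (l.foldr (fun i h => if i ∈ S then cellAvg N L i h else h - cellAvg N L i h) g) := by
  -- adapted from `continuous_foldr` of `BECThomsonPrincipleGaussianDominationCanThetaNorm.lean`
  induction l with
  | nil => exact hg
  | cons a l ih =>
    rw [List.foldr_cons]
    by_cases haS : a ∈ S
    · rw [if_pos haS]; exact continuous_cellAvg a ih
    · rw [if_neg haS]; exact ih.sub (continuous_cellAvg a ih)

/-- `Q_S g` is continuous for continuous `g`. [folklore] -/
theorem continuous_modeProj (S : Finset (Fin N)) {g : Config N → ℂ} (hg : Continuous g) :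
    Continuous (modeProj N L S g) :=
  continuous_foldr_cellAvg S (List.finRange N) hg

/-- `Θ_ψ` is continuous for continuous `ψ`. [folklore] -/
theorem continuous_theta {ψ : Config (m + 1) → ℂ} (hψ : Continuous ψ) :
    Continuous (theta m L ψ) := by
  unfold theta
  exact continuous_finsetSum _ fun S _ => continuous_const.mul (continuous_modeProj S hψ)

/-- The crux's phase `e^{ik·x₀}` is continuous. [folklore] -/
theorem continuous_phase (m : ℕ) (L : ℝ) (n : Fin 3 → ℤ) : Continuous (phase m L n) := by
  have h : phase m L n = fun X => cellWave L n (X 0) := funext (phase_eq_cellWave m L n)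
  rw [h]
  exact (continuous_cellWave L n).comp (continuous_apply 0)

/-! ## Linearity of `Q_S` and `Θ` on continuous functions -/

/-- The `foldr` is additive on continuous functions. [folklore] -/
theorem foldr_cellAvg_add (S : Finset (Fin N)) (l : List (Fin N)) {f g : Config N → ℂ}
    (hf : Continuous f) (hg : Continuous g) :
    l.foldr (fun i h => if i ∈ S then cellAvg N L i h else h - cellAvg N L i h) (f + g) =
      l.foldr (fun i h => if i ∈ S then cellAvg N L i h else h - cellAvg N L i h) f +
        l.foldr (fun i h => if i ∈ S then cellAvg N L i h else h - cellAvg N L i h) g := by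
  induction l with
  | nil => rfl
  | cons a l ih =>
    have hcf := continuous_foldr_cellAvg (L := L) S l hf
    have hcg := continuous_foldr_cellAvg (L := L) S l hg
    simp only [List.foldr_cons]
    rw [ih]
    by_cases haS : a ∈ S
    · simp only [if_pos haS]
      exact cellAvg_add a hcf hcg
    · simp only [if_neg haS]
      rw [cellAvg_add a hcf hcg]
      abel

/-- The `foldr` is homogeneous. [folklore] -/
theorem foldr_cellAvg_const_mul (S : Finset (Fin N)) (l : List (Fin N)) (c : ℂ)
    (g : Config N → ℂ) :
    l.foldr (fun i h => if i ∈ S then cellAvg N L i h else h - cellAvg N L i h) (fun X => c * g X) =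
      fun X => c *
        l.foldr (fun i h => if i ∈ S then cellAvg N L i h else h - cellAvg N L i h) g X := by
  induction l with
  | nil => rfl
  | cons a l ih =>
    simp only [List.foldr_cons]
    rw [ih]
    by_cases haS : a ∈ S
    · simp only [if_pos haS]
      exact cellAvg_const_mul a c _
    · simp only [if_neg haS]
      rw [cellAvg_const_mul a c _]
      funext X
      simp only [Pi.sub_apply]
      ring

/-- **`Q_S` is additive** on continuous functions. [folklore] -/
theorem modeProj_add (S : Finset (Fin N)) {f g : Config N → ℂ} (hf : Continuous f)
    (hg : Continuous g) :
    modeProj N L S (f + g) = modeProj N L S f + modeProj N L S g :=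
  foldr_cellAvg_add S _ hf hg

/-- **`Q_S` is homogeneous.** [folklore] -/
theorem modeProj_const_mul (S : Finset (Fin N)) (c : ℂ) (g : Config N → ℂ) :
    modeProj N L S (fun X => c * g X) = fun X => c * modeProj N L S g X :=
  foldr_cellAvg_const_mul S _ c g

/-- **`Θ` is additive** on continuous functions. [folklore] -/
theorem theta_add {f g : Config (m + 1) → ℂ} (hf : Continuous f) (hg : Continuous g) :
    theta m L (f + g) = theta m L f + theta m L g := by
  funext X
  simp only [Pi.add_apply]
  unfold theta
  rw [← Finset.sum_add_distrib]
  refine Finset.sum_congr rfl fun S _ => ?_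
  rw [modeProj_add S hf hg, Pi.add_apply, mul_add]

/-- **`Θ` is homogeneous.** [folklore] -/
theorem theta_const_mul (c : ℂ) (g : Config (m + 1) → ℂ) :
    theta m L (fun X => c * g X) = fun X => c * theta m L g X := by
  funext X
  unfold theta
  rw [Finset.mul_sum]
  refine Finset.sum_congr rfl fun S _ => ?_
  rw [modeProj_const_mul S c g]
  ring

/-! ## Sesquilinearity of the source pairing -/

/-- The integrand of `σ_n(g, h)` is integrable on the cell for continuous `g, h`. [folklore] -/
theorem integrable_srcIntegrand (n : Fin 3 → ℤ) {g h : Config (m + 1) → ℂ} (hg : Continuous g)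
    (hh : Continuous h) :
    Integrable (fun X => conj (g X) * phase m L n X * theta m L h X)
      ((volume : Measure (Config (m + 1))).restrict (cellN (m + 1) L)) :=
  integrableOn_cellN (((Complex.continuous_conj.comp hg).mul (continuous_phase m L n)).mul
    (continuous_theta hh)) L

/-- `σ` is additive in the first slot (continuous functions). [folklore] -/
theorem srcPair_add_left (n : Fin 3 → ℤ) {f g h : Config (m + 1) → ℂ} (hf : Continuous f)
    (hg : Continuous g) (hh : Continuous h) :
    srcPair m L n (f + g) h = srcPair m L n f h + srcPair m L n g h := by
  unfold srcPair
  rw [← integral_add (integrable_srcIntegrand n hf hh) (integrable_srcIntegrand n hg hh)]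
  refine integral_congr_ae (Eventually.of_forall fun X => ?_)
  simp only [Pi.add_apply, map_add]
  ring

/-- `σ` is additive in the second slot (continuous functions). [folklore] -/
theorem srcPair_add_right (n : Fin 3 → ℤ) {f g h : Config (m + 1) → ℂ} (hf : Continuous f)
    (hg : Continuous g) (hh : Continuous h) :
    srcPair m L n f (g + h) = srcPair m L n f g + srcPair m L n f h := by
  unfold srcPair
  rw [theta_add hg hh,
    ← integral_add (integrable_srcIntegrand n hf hg) (integrable_srcIntegrand n hf hh)]
  refine integral_congr_ae (Eventually.of_forall fun X => ?_)
  simp only [Pi.add_apply]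
  ring

/-- `σ` is conjugate-homogeneous in the first slot. [folklore] -/
theorem srcPair_const_mul_left (n : Fin 3 → ℤ) (c : ℂ) (f h : Config (m + 1) → ℂ) :
    srcPair m L n (fun X => c * f X) h = conj c * srcPair m L n f h := by
  unfold srcPair
  rw [← integral_const_mul]
  refine integral_congr_ae (Eventually.of_forall fun X => ?_)
  simp only [map_mul]
  ring

/-- `σ` is homogeneous in the second slot. [folklore] -/
theorem srcPair_const_mul_right (n : Fin 3 → ℤ) (c : ℂ) (f h : Config (m + 1) → ℂ) :
    srcPair m L n f (fun X => c * h X) = c * srcPair m L n f h := by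
  unfold srcPair
  rw [theta_const_mul, ← integral_const_mul]
  refine integral_congr_ae (Eventually.of_forall fun X => ?_)
  simp only
  ring

/-- **The diagonal of `σ` along a line**:
`σ(ψ + cζ, ψ + cζ) = σ(ψ,ψ) + (conj(c) σ(ζ,ψ) + c σ(ψ,ζ)) + conj(c) c σ(ζ,ζ)`. [folklore] -/
theorem srcPair_line (n : Fin 3 → ℤ) {ψ ζ : Config (m + 1) → ℂ} (hψ : Continuous ψ)
    (hζ : Continuous ζ) (c : ℂ) :
    srcPair m L n (fun X => ψ X + c * ζ X) (fun X => ψ X + c * ζ X) =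
      srcPair m L n ψ ψ + (conj c * srcPair m L n ζ ψ + c * srcPair m L n ψ ζ) +
        conj c * c * srcPair m L n ζ ζ := by
  have hcζ : Continuous fun X => c * ζ X := continuous_const.mul hζ
  have h : (fun X => ψ X + c * ζ X) = ψ + fun X => c * ζ X := rfl
  rw [h, srcPair_add_left n hψ hcζ (hψ.add hcζ), srcPair_add_right n hψ hψ hcζ,
    srcPair_add_right n hcζ hψ hcζ, srcPair_const_mul_left, srcPair_const_mul_left,
    srcPair_const_mul_right, srcPair_const_mul_right]
  ring

/-- Along a REAL line: `σ(ψ + tζ, ψ + tζ) = σ(ψ,ψ) + t(σ(ζ,ψ) + σ(ψ,ζ)) + t²σ(ζ,ζ)`. [folklore] -/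
theorem srcPair_line_real (n : Fin 3 → ℤ) {ψ ζ : Config (m + 1) → ℂ} (hψ : Continuous ψ)
    (hζ : Continuous ζ) (t : ℝ) :
    srcPair m L n (fun X => ψ X + (t : ℂ) * ζ X) (fun X => ψ X + (t : ℂ) * ζ X) =
      srcPair m L n ψ ψ + (t : ℂ) * (srcPair m L n ζ ψ + srcPair m L n ψ ζ) +
        (t : ℂ) ^ 2 * srcPair m L n ζ ζ := by
  rw [srcPair_line n hψ hζ (t : ℂ), Complex.conj_ofReal]
  ring

/-- Along a REAL line, backwards: `σ(ψ - tζ, ψ - tζ) = σ(ψ,ψ) - t(σ(ζ,ψ) + σ(ψ,ζ)) + t²σ(ζ,ζ)`.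
[folklore] -/
theorem srcPair_line_real_neg (n : Fin 3 → ℤ) {ψ ζ : Config (m + 1) → ℂ} (hψ : Continuous ψ)
    (hζ : Continuous ζ) (t : ℝ) :
    srcPair m L n (fun X => ψ X - (t : ℂ) * ζ X) (fun X => ψ X - (t : ℂ) * ζ X) =
      srcPair m L n ψ ψ - (t : ℂ) * (srcPair m L n ζ ψ + srcPair m L n ψ ζ) +
        (t : ℂ) ^ 2 * srcPair m L n ζ ζ := by
  have h : (fun X => ψ X - (t : ℂ) * ζ X) = fun X => ψ X + (-(t : ℂ)) * ζ X := by
    funext X; ring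
  rw [h, srcPair_line n hψ hζ (-(t : ℂ)), map_neg, Complex.conj_ofReal]
  ring

/-! ## The diagonal vanishes on null functions -/

/-- A continuous function of zero mass on the cell has `σ(f, f) = 0`. [folklore] -/
theorem srcPair_self_eq_zero_of_mass_eq_zero (n : Fin 3 → ℤ) {f : Config (m + 1) → ℂ}
    (hf : Continuous f) (h0 : mass L f = 0) : srcPair m L n f f = 0 := by
  unfold mass at h0
  have hmeas : Measurable fun X => ((‖f X‖₊ : ℝ≥0∞)) ^ 2 :=
    (hf.measurable.nnnorm.coe_nnreal_ennreal).pow_const _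
  have hae := (lintegral_eq_zero_iff hmeas).1 h0
  unfold srcPair
  refine integral_eq_zero_of_ae ?_
  filter_upwards [hae] with X hX
  have hfX : f X = 0 := by
    simpa [pow_eq_zero_iff, ENNReal.coe_eq_zero, nnnorm_eq_zero] using hX
  simp [hfX]

end ChordVariation

open Literature.MathematicalPhysics.QuantumManyBody.BoseGas in
/-- **Part 1 of `stub_chordVariation` (registered helper statement)**: along a real line the diagonal of the
source pairing is the quadratic polynomial `σ(ψ+tζ, ψ+tζ) = σ(ψ,ψ) + t(σ(ζ,ψ) + σ(ψ,ζ)) + t²σ(ζ,ζ)`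
(continuous `ψ, ζ`). [folklore] -/
theorem chordVariation_srcPair_line :
    ∀ (m : ℕ) (L : ℝ) (n : Fin 3 → ℤ)
      (ψ ζ : Literature.MathematicalPhysics.QuantumManyBody.BoseGas.Config (m + 1) → ℂ),
      Continuous ψ → Continuous ζ → ∀ t : ℝ,
        srcPair m L n (fun X => ψ X + (t : ℂ) * ζ X) (fun X => ψ X + (t : ℂ) * ζ X) =
          srcPair m L n ψ ψ + (t : ℂ) * (srcPair m L n ζ ψ + srcPair m L n ψ ζ) +
            (t : ℂ) ^ 2 * srcPair m L n ζ ζ :=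
  fun _ _ n _ _ hψ hζ t => ChordVariation.srcPair_line_real n hψ hζ t

end Summit.AtomisticToContinuum.BoseEinsteinCondensation.Cruxes.GDTransfer.DysonDressedWitness

end
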